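import Summits.CriticalPhenomena.PercolationContinuityZ3.Theorems.Transplant.SkelNegBParamsFaceFloorsClrXA
import Summits.CriticalPhenomena.PercolationContinuityZ3.Theorems.Transplant.SkelNegBParamsSlotsF
import HarnessLib

/-!
# N1 params, M3′ (y′-face floors at the (ζ′) tuple), group G-fit′ — **THE y′-RUN WIDTH FLOOR `hW`** of `Skelφ.FloorsY2` at the (F) wrapper's consumer
# shape (HOME prim-hp-8/F-GLUE-CONSUMER-SHAPE.md §3, binder `floorsY`): `(N_r+1)·(W − s_lo) + q_B + (N_r+1)·R′ + 2 ≤ W` with `W = ⌊n_Lℓ_L/U⌋ + 1`,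
# `s_lo = ⌊(n_Lℓ_L − U + 1)/U⌋` (so `W − s_lo ≤ 2`), `U = n_L + |h_L| ≤ 11 n_L`, under the y′-run count cap `N_r + 1 ≤ 600·Kq`, a start half-width
# budget `q_B ≤ 1000·Kq·(RA′+2)` and the ×Kq length floor `22000·Kq·(RA′+2) ≤ ℓ_L` (hp-8 g36, 2026-08-22; y′-face twins per lead 06:53:24Z; the field
# `hq₃` is FaceRunA's `hq₃Y_RA`).
builds on p205010 (kernel theorem, internal audit signed; external expert review pending) — nothing in this file uses p205010; NOTHING is claimed about the node
`SamePDropOfSkeletonNeg₁` (OPEN); integer arithmetic only.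
Lane `prim-bschramm`, seat `prim-hp-8` (gen 36); helper file (`--supports stmt-CriticalPhenomena-4575 --as helper`); slot-ledger ζ′ v1/v2.
* `ediv_step_le_two` (`⌊a/U⌋ + 1 − ⌊(a − U + 1)/U⌋ ≤ 2`), **`hW_YA`**.
[cite: KozmaNitzan2024, §4 Lemma 12 (pp. 23–25)] [cite: MartineauTassion2017, §4.1]
-/

noncomputable section

open scoped Classical

namespace Summit.CriticalPhenomena.PercolationContinuityZ3.Theorems.Transplant

namespace PlanarSkeletonNeg

namespace NegB

open Literature.Probability.Percolation Literature.Probability.LatticeModels SimpleGraph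
open SkelConc (Consts)
open Skelφ (shearUnit)
open Skelφ.StepI (DataN)
open Neg

namespace KS

/-- `⌊a/U⌋ + 1 − ⌊(a − U + 1)/U⌋ ≤ 2` for `0 < U`. [folklore] -/
theorem ediv_step_le_two (a : ℤ) {U : ℤ} (hU : 0 < U) : a / U + 1 - (a - U + 1) / U ≤ 2 := by
  have h1 : (a - U) / U = a / U - 1 := by
    rw [show a - U = a + (-1) * U by ring, Int.add_mul_ediv_right _ _ hU.ne']; ring
  have h2 : (a - U) / U ≤ (a - U + 1) / U := Int.ediv_le_ediv hU (by linarith)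
  linarith

section WidthY

variable (κ : Consts) {V : Type} [DecidableEq V] [Countable V] {G : SimpleGraph V} [G.LocallyFinite] (Φ : PlanarSkeletonNeg G) (t : V)
  (p : unitInterval) (D : DataN V) (mk g f : ℕ)

/-- **M3′ y′-face field `hW`** at the (ζ′) tuple: `(N_r+1)·(W − s_lo) + q_B + (N_r+1)·RA′ + 2 ≤ W`. [cite: KozmaNitzan2024, §4 Lemma 12 (pp. 23–25)] -/
theorem hW_YA (hN : EqNumL κ Φ t p D g f) (hκ : (hL κ Φ t p D g f).natAbs ≤ 10 * nL κ Φ t p D g f)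
    (hℓA : 22000 * Neg.Kq κ * (RA' κ Φ t p D mk + 2) ≤ ℓL κ Φ t p D g f) {Nr qB : ℕ} (hNr : Nr + 1 ≤ 600 * Neg.Kq κ)
    (hqB : (qB : ℤ) ≤ 1000 * (Neg.Kq κ : ℤ) * ((RA' κ Φ t p D mk : ℤ) + 2)) :
    ((Nr : ℤ) + 1) * ((((nL κ Φ t p D g f) : ℤ) * (ℓL κ Φ t p D g f) / (shearUnit (nL κ Φ t p D g f) (prFA κ Φ t p D g f).h : ℕ) + 1) - (((nL κ Φ t p D g f) : ℤ) * (ℓL κ Φ t p D g f) - (shearUnit (nL κ Φ t p D g f) (prFA κ Φ t p D g f).h : ℕ) + 1) / (shearUnit (nL κ Φ t p D g f) (prFA κ Φ t p D g f).h : ℕ)) + qB +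
        ((Nr : ℤ) + 1) * (RA' κ Φ t p D mk) + 2 ≤ (((nL κ Φ t p D g f) * (ℓL κ Φ t p D g f) / shearUnit (nL κ Φ t p D g f) (prFA κ Φ t p D g f).h + 1 : ℕ) : ℤ) := by
  obtain ⟨hn1, hℓ1⟩ := one_le_of_eqNumL κ Φ t p D g f hN
  obtain ⟨hU1, hU2⟩ := clr_shearUnit_bounds κ Φ t p D g f hκ
  have hh : (prFA κ Φ t p D g f).h = hL κ Φ t p D g f := rfl
  rw [hh]
  have hn : (1 : ℤ) ≤ ((nL κ Φ t p D g f) : ℤ) := by exact_mod_cast hn1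
  have hNr' : (Nr : ℤ) + 1 ≤ 600 * (Neg.Kq κ : ℤ) := by exact_mod_cast hNr
  have hℓ' : 22000 * (Neg.Kq κ : ℤ) * ((RA' κ Φ t p D mk : ℤ) + 2) ≤ ((ℓL κ Φ t p D g f) : ℤ) := by exact_mod_cast hℓA
  set U : ℤ := (shearUnit (nL κ Φ t p D g f) (hL κ Φ t p D g f) : ℤ) with hUdef
  set n : ℤ := ((nL κ Φ t p D g f) : ℤ)
  set ℓ : ℤ := ((ℓL κ Φ t p D g f) : ℤ)
  have hUpos : 0 < U := by linarith
  have hstep := ediv_step_le_two (n * ℓ) hUpos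
  have hq1 : (1 : ℤ) ≤ Neg.Kq κ := by exact_mod_cast Neg.one_le_Kq κ
  have hR0 : (0 : ℤ) ≤ (RA' κ Φ t p D mk : ℤ) := Nat.cast_nonneg _
  have hNr0 : (0 : ℤ) ≤ (Nr : ℤ) := Nat.cast_nonneg _
  -- the width `W = ⌊nℓ/U⌋ + 1 ≥ ℓ/11`
  have hW : ℓ ≤ 11 * (n * ℓ / U + 1) := by
    obtain ⟨f1, f2⟩ := RootArith.floor_sandwich (x := n * ℓ) (d := U) hUpos
    have hℓ0 : 0 ≤ ℓ := by linarith
    nlinarith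
  have ecast : (((nL κ Φ t p D g f) * (ℓL κ Φ t p D g f) / shearUnit (nL κ Φ t p D g f) (hL κ Φ t p D g f) + 1 : ℕ) : ℤ) = n * ℓ / U + 1 := by push_cast; rfl
  rw [ecast]
  have hd0 : 0 ≤ n * ℓ / U + 1 - (n * ℓ - U + 1) / U := by
    have : (n * ℓ - U + 1) / U ≤ n * ℓ / U := Int.ediv_le_ediv hUpos (by linarith)
    linarith
  have h1 : ((Nr : ℤ) + 1) * (n * ℓ / U + 1 - (n * ℓ - U + 1) / U) ≤ 2 * ((Nr : ℤ) + 1) := by nlinarith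
  have h2 : ((Nr : ℤ) + 1) * (RA' κ Φ t p D mk : ℤ) ≤ 600 * (Neg.Kq κ : ℤ) * (RA' κ Φ t p D mk : ℤ) := mul_le_mul_of_nonneg_right hNr' hR0
  nlinarith

end WidthY

section WidthY2

variable (κ : Consts) {V : Type} [DecidableEq V] [Countable V] {G : SimpleGraph V} [G.LocallyFinite] (Φ : PlanarSkeletonNeg G) (t : V)
  (p : unitInterval) (D : DataN V) (c mk g f : ℕ)

set_option maxHeartbeats 800000 in
/-- **M3′ y′-face field `hW`, SERVED FORM** (stmt-g17 10:05:23Z: the y′ landing half-height `qB′ := qBF` is `≈ n_Lℓ_L/(2U)`, so `hW_YA`'s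
`qB ≤ 1000Kq(RA′+2)` is not dischargeable; this twin takes instead the budget `2·(U·qB) ≤ n_L·ℓ_L + n_L·(21·S_F + 22·RA′ + 130)` (= stmt's
`KS.two_U_qBF_le` at `qB := qBF`) and the floor `64·S_F ≤ M_L` (`KS.ML_floorsA….2.2.1`)). [cite: KozmaNitzan2024, §4 Lemma 12 (pp. 23–25)] -/
theorem hW_YA₂ (hN : EqNumL κ Φ t p D g f) (hκ : (hL κ Φ t p D g f).natAbs ≤ 10 * nL κ Φ t p D g f)
    (hℓA : 22000 * Neg.Kq κ * (RA' κ Φ t p D mk + 2) ≤ ℓL κ Φ t p D g f) (hS64 : 64 * SF κ Φ t p D c mk ≤ ML κ Φ t p D g) {Nr qB : ℕ}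
    (hNr : Nr + 1 ≤ 600 * Neg.Kq κ)
    (hqB2 : 2 * ((shearUnit (nL κ Φ t p D g f) (hL κ Φ t p D g f) : ℤ) * qB) ≤ ((nL κ Φ t p D g f) : ℤ) * (ℓL κ Φ t p D g f) + ((nL κ Φ t p D g f) : ℤ) * (21 * (SF κ Φ t p D c mk : ℤ) + 22 * (RA' κ Φ t p D mk : ℤ) + 130)) :
    ((Nr : ℤ) + 1) * ((((nL κ Φ t p D g f) : ℤ) * (ℓL κ Φ t p D g f) / (shearUnit (nL κ Φ t p D g f) (prFA κ Φ t p D g f).h : ℕ) + 1) - (((nL κ Φ t p D g f) : ℤ) * (ℓL κ Φ t p D g f) - (shearUnit (nL κ Φ t p D g f) (prFA κ Φ t p D g f).h : ℕ) + 1) / (shearUnit (nL κ Φ t p D g f) (prFA κ Φ t p D g f).h : ℕ)) + qB +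
        ((Nr : ℤ) + 1) * (RA' κ Φ t p D mk) + 2 ≤ (((nL κ Φ t p D g f) * (ℓL κ Φ t p D g f) / shearUnit (nL κ Φ t p D g f) (prFA κ Φ t p D g f).h + 1 : ℕ) : ℤ) := by
  obtain ⟨hn1, hℓ1⟩ := one_le_of_eqNumL κ Φ t p D g f hN
  obtain ⟨hU1, hU2⟩ := clr_shearUnit_bounds κ Φ t p D g f hκ
  have hMℓ := hN.ℓ_le
  have hh : (prFA κ Φ t p D g f).h = hL κ Φ t p D g f := rfl
  rw [hh]
  have hn : (1 : ℤ) ≤ ((nL κ Φ t p D g f) : ℤ) := by exact_mod_cast hn1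
  have hNr' : (Nr : ℤ) + 1 ≤ 600 * (Neg.Kq κ : ℤ) := by exact_mod_cast hNr
  have hℓ' : 22000 * (Neg.Kq κ : ℤ) * ((RA' κ Φ t p D mk : ℤ) + 2) ≤ ((ℓL κ Φ t p D g f) : ℤ) := by exact_mod_cast hℓA
  have hS' : 64 * (SF κ Φ t p D c mk : ℤ) ≤ (ML κ Φ t p D g : ℤ) := by exact_mod_cast hS64
  set Uz : ℤ := (shearUnit (nL κ Φ t p D g f) (hL κ Φ t p D g f) : ℤ) with hUdef
  set n : ℤ := ((nL κ Φ t p D g f) : ℤ)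
  set ℓ : ℤ := ((ℓL κ Φ t p D g f) : ℤ)
  set S : ℤ := (SF κ Φ t p D c mk : ℤ)
  set R : ℤ := (RA' κ Φ t p D mk : ℤ)
  have hUpos : 0 < Uz := by linarith
  have hstep := ediv_step_le_two (n * ℓ) hUpos
  have hq1 : (1 : ℤ) ≤ Neg.Kq κ := by exact_mod_cast Neg.one_le_Kq κ
  have hR0 : (0 : ℤ) ≤ R := Nat.cast_nonneg _
  have hS0 : (0 : ℤ) ≤ S := Nat.cast_nonneg _
  have hNr0 : (0 : ℤ) ≤ (Nr : ℤ) := Nat.cast_nonneg _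
  have hq0 : (0 : ℤ) ≤ (qB : ℤ) := Nat.cast_nonneg _
  -- `U·W ≥ nℓ` for `W = ⌊nℓ/U⌋ + 1`
  have ecast : (((nL κ Φ t p D g f) * (ℓL κ Φ t p D g f) / shearUnit (nL κ Φ t p D g f) (hL κ Φ t p D g f) + 1 : ℕ) : ℤ) = n * ℓ / Uz + 1 := by push_cast; rfl
  rw [ecast]
  obtain ⟨f1, f2⟩ := RootArith.floor_sandwich (x := n * ℓ) (d := Uz) hUpos
  have hd0 : 0 ≤ n * ℓ / Uz + 1 - (n * ℓ - Uz + 1) / Uz := by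
    have : (n * ℓ - Uz + 1) / Uz ≤ n * ℓ / Uz := Int.ediv_le_ediv hUpos (by linarith)
    linarith
  -- it suffices that `U·LHS ≤ U·W`; we bound `U·LHS ≤ nℓ < U·W`
  have h1 : ((Nr : ℤ) + 1) * (n * ℓ / Uz + 1 - (n * ℓ - Uz + 1) / Uz) ≤ 2 * ((Nr : ℤ) + 1) := by nlinarith
  have key : Uz * (2 * ((Nr : ℤ) + 1) + (qB : ℤ) + ((Nr : ℤ) + 1) * R + 2) ≤ n * ℓ := by
    have a : Uz * (2 * ((Nr : ℤ) + 1) + ((Nr : ℤ) + 1) * R + 2) ≤ 11 * n * (((Nr : ℤ) + 1) * (R + 2) + 2) := by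
      have : 2 * ((Nr : ℤ) + 1) + ((Nr : ℤ) + 1) * R + 2 = ((Nr : ℤ) + 1) * (R + 2) + 2 := by ring
      rw [this]; exact mul_le_mul_of_nonneg_right hU2 (by positivity)
    have b : ((Nr : ℤ) + 1) * (R + 2) ≤ 600 * (Neg.Kq κ : ℤ) * (R + 2) := mul_le_mul_of_nonneg_right hNr' (by linarith)
    have b' : 11 * n * (((Nr : ℤ) + 1) * (R + 2) + 2) ≤ 11 * n * (600 * (Neg.Kq κ : ℤ) * (R + 2) + 2) :=
      mul_le_mul_of_nonneg_left (by linarith) (by linarith)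
    have hMℓ' : (ML κ Φ t p D g : ℤ) + 1 ≤ ℓ := by exact_mod_cast hMℓ
    have i1 : 63 * S ≤ ℓ := by linarith
    have hKR : R + 2 ≤ (Neg.Kq κ : ℤ) * (R + 2) := by nlinarith
    have i2 : 3 * (13200 * (Neg.Kq κ : ℤ) * (R + 2) + 22 * R + 174) ≤ 2 * ℓ := by nlinarith
    have i3 : 13200 * (Neg.Kq κ : ℤ) * (R + 2) + 44 + 21 * S + 22 * R + 130 ≤ ℓ := by linarith
    have c2 : n * (13200 * (Neg.Kq κ : ℤ) * (R + 2) + 44 + 21 * S + 22 * R + 130) ≤ n * ℓ := mul_le_mul_of_nonneg_left i3 (by linarith)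
    have e : Uz * (2 * ((Nr : ℤ) + 1) + (qB : ℤ) + ((Nr : ℤ) + 1) * R + 2) = Uz * (qB : ℤ) + Uz * (2 * ((Nr : ℤ) + 1) + ((Nr : ℤ) + 1) * R + 2) := by ring
    rw [e]
    linarith
  -- conclude: `U·LHS ≤ nℓ < U·W`
  have h2 : Uz * (((Nr : ℤ) + 1) * (n * ℓ / Uz + 1 - (n * ℓ - Uz + 1) / Uz) + (qB : ℤ) + ((Nr : ℤ) + 1) * R + 2) ≤
      Uz * (2 * ((Nr : ℤ) + 1) + (qB : ℤ) + ((Nr : ℤ) + 1) * R + 2) := mul_le_mul_of_nonneg_left (by linarith) hUpos.le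
  have eW : Uz * (n * ℓ / Uz + 1) = Uz * (n * ℓ / Uz) + Uz := by ring
  have h3 : Uz * (((Nr : ℤ) + 1) * (n * ℓ / Uz + 1 - (n * ℓ - Uz + 1) / Uz) + (qB : ℤ) + ((Nr : ℤ) + 1) * R + 2) < Uz * (n * ℓ / Uz + 1) := by
    rw [eW]; linarith
  exact (lt_of_mul_lt_mul_left h3 hUpos.le).le

end WidthY2

end KS

end NegB

end PlanarSkeletonNeg

end Summit.CriticalPhenomena.PercolationContinuityZ3.Theorems.Transplant

end
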